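import Literature.Probability.Percolation.TripodExchange
import Summits.CriticalPhenomena.PercolationContinuityZ3.Theorems.PercNearOneGluingNoHeavyLowerTailLonelyRelay
import Summits.CriticalPhenomena.PercolationContinuityZ3.Theorems.PercNearOneGluingNoHeavyLowerTailWorstPairExchangeCex
import HarnessLib

/-!
# Runbook sanity lemmas — the primary programme's two headline inequalities
# (`tripodExchange`, `oneCut_card_le_four`): kernel-checked TIGHTNESS instances

Reader-facing companions of the two STATEMENT cards of
`run/shared/lean/prim/REVIEW-RUNBOOK-tripodExchange-oneCut.md` (ops-runbook generator, client
`prim-primary`).  The cards quote exact tightness / sanity numbers from the cell's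
`runbook-input/STATEMENT.md`; this file re-derives the three quoted instances INSIDE LEAN, with the
same constants the headline theorems use (`prodBernoulli`, `openConn`, the `A.filter … .card` relay
count), so that a reviewer can cite a kernel-checked declaration instead of a prose number.

HONEST FRAMING.  Both headline theorems are unconditional finite correlation inequalities for
independent bond percolation (proved in the tree from van den Berg–Häggström–Kahn 2006, Thms 1.5 / 1.3,
themselves proved in the tree); they were the `|A| ≤ 3` / `|A| ≤ 4` rungs of the one-cut engine toward
crux `NoHeavyLowerTail` (stmt-CriticalPhenomena-4575), which was closed by a different route.  Nothing
here is used by any theorem of the tree; these are checks (`--supports`; the file closes no item).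

Method.  All probabilities below are EXACT rationals, obtained from the tree's weighted evaluation
machinery (`AdditiveGluing/Negative/CertWeighted.lean`, `…WorstPairExchangeCex.real_eq_wcount`): for a
weighted edge list `l`, `prodBernoulli (wOfList l)` puts weight `q_e` on the listed pairs and `0` on
every other pair, and the probability of any event is its weighted count over the `2^m`
sub-configurations of the `m` listed pairs.  Each statement names its witness by the hypothesis
`hl : l = [ … ]` (the weighted edge list, verbatim); the arithmetic is kernel `decide` (standard axioms,
no `native_decide`, no definitions).

* §1 `tripodExchange` is TIGHT: on the 4-cycle `o–x–z–y–o` (`Fin 4`: `o = 0, x = 1, z = 2, y = 3`),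
  all four weights `1/2`, each of the four tripod cells has probability exactly `1/16`
  (`tripod_cells_cycle4`: each cell is one cylinder — two prescribed edges open, the other two
  closed), so C⁺ (`tripodExchange (wOfList l) 0 1 3 2`) holds with EQUALITY `1/256 = 1/256` and a
  positive left-hand side (`tripodExchange_tight_cycle4`).
* §2 `oneCut_card_le_four` is TIGHT at `|A| = 4`: `Fin 5`, observer `o = 0` glued to relay `1`
  (weight `1`), relays `2, 3, 4` a blob (weights `1`), link `1–2` of weight `3/5`:
  `P(o ↔ a) = 1, 3/5, 3/5, 3/5`, `E N = 14/5` (`sum_openConn_blobLink`), every pairwise disconnection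
  probability is `≤ 2/5` (`pair_le_blobLink`) with `P(1 ↮ 2) = 2/5`, and `P(1 ≤ N < E N/2) = 2/5` — the
  bound `≤ t` is attained at `t = 2/5` (`oneCut_card_le_four_tight`; the theorem instantiated:
  `oneCut_blobLink_le`).
* §3 the hypothesis-free `|A| = 5` variant "`P(1 ≤ N ≤ 2) ≤ max_{a ≠ a'} P(a ↮ a')`" (T′(5) of the
  cell's notes) is FALSE: `K₅` on `Fin 5` with all weights `1/20`, `o = 0 ∈ A = univ`:
  `P(1 ≤ N ≤ 2) = 307687881/320000000 ≈ 0.9615 > 4824193716417/5120000000000 ≈ 0.9422 ≥ P(a ↮ a')`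
  for every pair, with equality for the pair `(0,1)` (`tPrime5_cex`, packaged as `not_tPrime5`); and
  `E N = 1575806283583/1280000000000 < 2` there (`sum_openConn_k5`), so the one-cut event
  `{1 ≤ N < E N/2}` of the headline statement is EMPTY at this instance — the `E N/2` threshold is
  exactly what an `|A| ≥ 5` statement must keep.
-/

namespace Summit.CriticalPhenomena.PercolationContinuityZ3.Runbook.Primary

open MeasureTheory
open Literature.Probability.LatticeModels Literature.Probability.Percolation
open Summit.CriticalPhenomena.PercolationContinuityZ3.Theorems.AdditiveGluing.Negative.Cert
open Summit.CriticalPhenomena.PercolationContinuityZ3.Theorems.WorstPairExchangeCex (real_eq_wcount)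

/-! ### Computable side: admissibility of the three witnesses and the exact counts (kernel `decide`) -/

section Compute

/-- §1 witness (4-cycle, weights `1/2`): the listed pairs are distinct. -/
theorem cycle4_nodup (l : List (Fin 4 × Fin 4 × ℚ))
    (hl : l = [(0, 1, 1/2), (1, 2, 1/2), (2, 3, 1/2), (0, 3, 1/2)]) : (wPairs l).Nodup := by
  subst hl; decide

/-- §1 witness: the weights lie in `[0, 1]`. -/
theorem cycle4_weights (l : List (Fin 4 × Fin 4 × ℚ))
    (hl : l = [(0, 1, 1/2), (1, 2, 1/2), (2, 3, 1/2), (0, 3, 1/2)]) :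
    ∀ e ∈ l, 0 ≤ e.2.2 ∧ e.2.2 ≤ 1 := by
  subst hl; decide +kernel

/-- §1 arithmetic (16 configurations): the exact counts of the four tripod cells
`{0↔1, 3↔2, 1↮3}`, `{0↔3, 1↔2, 1↮3}`, `{0↔1, 1↔2, 1↮3}`, `{0↔3, 3↔2, 1↮3}` are `1/16` each. -/
theorem cells_cycle4 (l : List (Fin 4 × Fin 4 × ℚ))
    (hl : l = [(0, 1, 1/2), (1, 2, 1/2), (2, 3, 1/2), (0, 3, 1/2)]) :
    ((wtabs 4 l).map fun t => if (t.1.getD (0 : Fin 4) 0).testBit (1 : Fin 4) &&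
        (t.1.getD (3 : Fin 4) 0).testBit (2 : Fin 4) && !(t.1.getD (1 : Fin 4) 0).testBit (3 : Fin 4)
        then t.2 else 0).sum = 1/16 ∧
    ((wtabs 4 l).map fun t => if (t.1.getD (0 : Fin 4) 0).testBit (3 : Fin 4) &&
        (t.1.getD (1 : Fin 4) 0).testBit (2 : Fin 4) && !(t.1.getD (1 : Fin 4) 0).testBit (3 : Fin 4)
        then t.2 else 0).sum = 1/16 ∧
    ((wtabs 4 l).map fun t => if (t.1.getD (0 : Fin 4) 0).testBit (1 : Fin 4) &&
        (t.1.getD (1 : Fin 4) 0).testBit (2 : Fin 4) && !(t.1.getD (1 : Fin 4) 0).testBit (3 : Fin 4)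
        then t.2 else 0).sum = 1/16 ∧
    ((wtabs 4 l).map fun t => if (t.1.getD (0 : Fin 4) 0).testBit (3 : Fin 4) &&
        (t.1.getD (3 : Fin 4) 0).testBit (2 : Fin 4) && !(t.1.getD (1 : Fin 4) 0).testBit (3 : Fin 4)
        then t.2 else 0).sum = 1/16 := by
  subst hl; decide +kernel

/-- §2 witness (`0` glued to `1`, blob `{2,3,4}`, link `1–2` of weight `3/5`): the listed pairs are
distinct. -/
theorem blobLink_nodup (l : List (Fin 5 × Fin 5 × ℚ))
    (hl : l = [(0, 1, 1), (1, 2, 3/5), (2, 3, 1), (3, 4, 1)]) : (wPairs l).Nodup := by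
  subst hl; decide

/-- §2 witness: the weights lie in `[0, 1]`. -/
theorem blobLink_weights (l : List (Fin 5 × Fin 5 × ℚ))
    (hl : l = [(0, 1, 1), (1, 2, 3/5), (2, 3, 1), (3, 4, 1)]) :
    ∀ e ∈ l, 0 ≤ e.2.2 ∧ e.2.2 ≤ 1 := by
  subst hl; decide +kernel

/-- §2 arithmetic (16 configurations): `P(0 ↔ 1) + P(0 ↔ 2) + P(0 ↔ 3) + P(0 ↔ 4)
= 1 + 3/5 + 3/5 + 3/5 = 14/5` (exact counts, bracketed as the `Finset` sum unfolds). -/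
theorem wConn_sum_blobLink (l : List (Fin 5 × Fin 5 × ℚ))
    (hl : l = [(0, 1, 1), (1, 2, 3/5), (2, 3, 1), (3, 4, 1)]) :
    wConn (wtabs 5 l) (0 : Fin 5) (1 : Fin 5) + (wConn (wtabs 5 l) (0 : Fin 5) (2 : Fin 5) +
      (wConn (wtabs 5 l) (0 : Fin 5) (3 : Fin 5) + wConn (wtabs 5 l) (0 : Fin 5) (4 : Fin 5))) = 14/5 := by
  subst hl; decide +kernel

/-- §2 arithmetic: every pairwise disconnection count among the relays `{1,2,3,4}` is at most `2/5`. -/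
theorem wNotConn_blobLink_le (l : List (Fin 5 × Fin 5 × ℚ))
    (hl : l = [(0, 1, 1), (1, 2, 3/5), (2, 3, 1), (3, 4, 1)]) :
    ∀ a ∈ ({1, 2, 3, 4} : Finset (Fin 5)), ∀ a' ∈ ({1, 2, 3, 4} : Finset (Fin 5)),
      wNotConn (wtabs 5 l) a a' ≤ 2/5 := by
  subst hl; decide +kernel

/-- §2 arithmetic: the disconnection count of the pair `(1, 2)` is exactly `2/5`. -/
theorem wNotConn_blobLink_one_two (l : List (Fin 5 × Fin 5 × ℚ))
    (hl : l = [(0, 1, 1), (1, 2, 3/5), (2, 3, 1), (3, 4, 1)]) :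
    wNotConn (wtabs 5 l) (1 : Fin 5) (2 : Fin 5) = 2/5 := by
  subst hl; decide +kernel

/-- §2 arithmetic: the exact count of `{N = 1}` (`N` = number of relays of `{1,2,3,4}` joined to `0`)
is `2/5`. -/
theorem cntOne_blobLink (l : List (Fin 5 × Fin 5 × ℚ))
    (hl : l = [(0, 1, 1), (1, 2, 3/5), (2, 3, 1), (3, 4, 1)]) :
    ((wtabs 5 l).map fun t => if decide ((({1, 2, 3, 4} : Finset (Fin 5)).filter
        fun z : Fin 5 => (t.1.getD 0 0).testBit z = true).card = 1) then t.2 else 0).sum = 2/5 := by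
  subst hl; decide +kernel

/-- §3 witness (`K₅`, weights `1/20`): the listed pairs are distinct. -/
theorem k5_nodup (l : List (Fin 5 × Fin 5 × ℚ))
    (hl : l = [(0, 1, 1/20), (0, 2, 1/20), (0, 3, 1/20), (0, 4, 1/20), (1, 2, 1/20), (1, 3, 1/20),
      (1, 4, 1/20), (2, 3, 1/20), (2, 4, 1/20), (3, 4, 1/20)]) : (wPairs l).Nodup := by
  subst hl; decide

/-- §3 witness: the weights lie in `[0, 1]`. -/
theorem k5_weights (l : List (Fin 5 × Fin 5 × ℚ))
    (hl : l = [(0, 1, 1/20), (0, 2, 1/20), (0, 3, 1/20), (0, 4, 1/20), (1, 2, 1/20), (1, 3, 1/20),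
      (1, 4, 1/20), (2, 3, 1/20), (2, 4, 1/20), (3, 4, 1/20)]) :
    ∀ e ∈ l, 0 ≤ e.2.2 ∧ e.2.2 ≤ 1 := by
  subst hl; decide +kernel

/-- §3 arithmetic (1024 configurations): the exact count of `{1 ≤ N ≤ 2}` (`N` = number of vertices
joined to `0`, `0` included) is `307687881/320000000`. -/
theorem cntLe2_k5 (l : List (Fin 5 × Fin 5 × ℚ))
    (hl : l = [(0, 1, 1/20), (0, 2, 1/20), (0, 3, 1/20), (0, 4, 1/20), (1, 2, 1/20), (1, 3, 1/20),
      (1, 4, 1/20), (2, 3, 1/20), (2, 4, 1/20), (3, 4, 1/20)]) :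
    ((wtabs 5 l).map fun t => if decide (1 ≤ ((Finset.univ : Finset (Fin 5)).filter
          fun z : Fin 5 => (t.1.getD 0 0).testBit z = true).card ∧
        ((Finset.univ : Finset (Fin 5)).filter
          fun z : Fin 5 => (t.1.getD 0 0).testBit z = true).card ≤ 2) then t.2 else 0).sum =
      307687881/320000000 := by
  subst hl; decide +kernel

/-- §3 arithmetic: every pairwise disconnection count is at most `4824193716417/5120000000000`
(all equal by symmetry; checked pair by pair). -/
theorem wNotConn_k5_le (l : List (Fin 5 × Fin 5 × ℚ))
    (hl : l = [(0, 1, 1/20), (0, 2, 1/20), (0, 3, 1/20), (0, 4, 1/20), (1, 2, 1/20), (1, 3, 1/20),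
      (1, 4, 1/20), (2, 3, 1/20), (2, 4, 1/20), (3, 4, 1/20)]) :
    ∀ a a' : Fin 5, wNotConn (wtabs 5 l) a a' ≤ 4824193716417/5120000000000 := by
  subst hl; decide +kernel

/-- §3 arithmetic: the disconnection count of the pair `(0, 1)` is exactly
`4824193716417/5120000000000`. -/
theorem wNotConn_k5_zero_one (l : List (Fin 5 × Fin 5 × ℚ))
    (hl : l = [(0, 1, 1/20), (0, 2, 1/20), (0, 3, 1/20), (0, 4, 1/20), (1, 2, 1/20), (1, 3, 1/20),
      (1, 4, 1/20), (2, 3, 1/20), (2, 4, 1/20), (3, 4, 1/20)]) :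
    wNotConn (wtabs 5 l) (0 : Fin 5) (1 : Fin 5) = 4824193716417/5120000000000 := by
  subst hl; decide +kernel

/-- §3 arithmetic: `Σ_{a = 0..4} P(0 ↔ a) = 1575806283583/1280000000000` (exact counts). -/
theorem wConn_sum_k5 (l : List (Fin 5 × Fin 5 × ℚ))
    (hl : l = [(0, 1, 1/20), (0, 2, 1/20), (0, 3, 1/20), (0, 4, 1/20), (1, 2, 1/20), (1, 3, 1/20),
      (1, 4, 1/20), (2, 3, 1/20), (2, 4, 1/20), (3, 4, 1/20)]) :
    wConn (wtabs 5 l) (0 : Fin 5) (0 : Fin 5) + wConn (wtabs 5 l) (0 : Fin 5) (1 : Fin 5) +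
      wConn (wtabs 5 l) (0 : Fin 5) (2 : Fin 5) + wConn (wtabs 5 l) (0 : Fin 5) (3 : Fin 5) +
      wConn (wtabs 5 l) (0 : Fin 5) (4 : Fin 5) = 1575806283583/1280000000000 := by
  subst hl; decide +kernel

end Compute

/-! ### Measure side -/

open scoped Classical

/-- The tripod cell `{a ↔ b} ∩ {c ↔ d} ∩ {e ↮ f}` under `prodBernoulli (wOfList l)` as an exact
weighted count over the reach tables. -/
theorem real_cell {n : ℕ} {l : List (Fin n × Fin n × ℚ)} (hnd : (wPairs l).Nodup)
    (hq : ∀ e ∈ l, 0 ≤ e.2.2 ∧ e.2.2 ≤ 1) (a b c d e f : Fin n) :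
    (prodBernoulli (wOfList l)).real (openConn a b ∩ openConn c d ∩ (openConn e f)ᶜ) =
      ((((wtabs n l).map fun t => if (t.1.getD a 0).testBit b && (t.1.getD c 0).testBit d &&
        !(t.1.getD e 0).testBit f then t.2 else 0).sum : ℚ) : ℝ) := by
  refine real_eq_wcount hnd hq (fun tb => (tb.getD a 0).testBit b && (tb.getD c 0).testBit d &&
    !(tb.getD e 0).testBit f) _ fun ω => ?_
  simp only [Bool.and_eq_true, Bool.not_eq_true', Set.mem_inter_iff, Set.mem_compl_iff]
  simp only [← testBit_reachTable_iff_mem_openConn, Bool.not_eq_true]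

/-- Per-configuration agreement of the relay count read off a reach table with the
`A.filter … .card` count of the headline statements. -/
theorem card_filter_reachTable {n : ℕ} (A : Finset (Fin n)) (o : Fin n) (ω : List (Fin n × Fin n)) :
    (A.filter fun z : Fin n => ((reachTable n ω).getD o 0).testBit z = true).card =
      (A.filter fun z => (↑(Eset ω) : Set (Sym2 (Fin n))) ∈ openConn o z).card := by
  rw [Finset.filter_congr fun z _ => testBit_reachTable_iff_mem_openConn ω o z]

/-! ### §1 The tripod exchange inequality is tight on the 4-cycle -/

/-- **§1, the four cells.**  On the 4-cycle `0–1–2–3–0` with weights `1/2` (`o = 0, x = 1, y = 3,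
z = 2`): `P(o↔x, y↔z, x↮y) = P(o↔y, x↔z, x↮y) = P(o↔x, x↔z, x↮y) = P(o↔y, y↔z, x↮y) = 1/16`. -/
theorem tripod_cells_cycle4 (l : List (Fin 4 × Fin 4 × ℚ))
    (hl : l = [(0, 1, 1/2), (1, 2, 1/2), (2, 3, 1/2), (0, 3, 1/2)]) :
    (prodBernoulli (wOfList l)).real
          (openConn (0 : Fin 4) 1 ∩ openConn (3 : Fin 4) 2 ∩ (openConn (1 : Fin 4) 3)ᶜ) = 1 / 16 ∧
      (prodBernoulli (wOfList l)).real
          (openConn (0 : Fin 4) 3 ∩ openConn (1 : Fin 4) 2 ∩ (openConn (1 : Fin 4) 3)ᶜ) = 1 / 16 ∧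
      (prodBernoulli (wOfList l)).real
          (openConn (0 : Fin 4) 1 ∩ openConn (1 : Fin 4) 2 ∩ (openConn (1 : Fin 4) 3)ᶜ) = 1 / 16 ∧
      (prodBernoulli (wOfList l)).real
          (openConn (0 : Fin 4) 3 ∩ openConn (3 : Fin 4) 2 ∩ (openConn (1 : Fin 4) 3)ᶜ) = 1 / 16 := by
  obtain ⟨h1, h2, h3, h4⟩ := cells_cycle4 l hl
  refine ⟨?_, ?_, ?_, ?_⟩ <;> rw [real_cell (cycle4_nodup l hl) (cycle4_weights l hl)]
  · rw [h1]; norm_num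
  · rw [h2]; norm_num
  · rw [h3]; norm_num
  · rw [h4]; norm_num

/-- **§1, tightness of C⁺.**  At the instance of `tripod_cells_cycle4` the tripod exchange inequality
(binders `o x y z ↦ 0 1 3 2`) holds with EQUALITY, `1/256 = 1/256`, and its left-hand side is positive. -/
theorem tripodExchange_tight_cycle4 (l : List (Fin 4 × Fin 4 × ℚ))
    (hl : l = [(0, 1, 1/2), (1, 2, 1/2), (2, 3, 1/2), (0, 3, 1/2)]) :
    (prodBernoulli (wOfList l)).real
          (openConn (0 : Fin 4) 1 ∩ openConn (3 : Fin 4) 2 ∩ (openConn (1 : Fin 4) 3)ᶜ) *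
        (prodBernoulli (wOfList l)).real
          (openConn (0 : Fin 4) 3 ∩ openConn (1 : Fin 4) 2 ∩ (openConn (1 : Fin 4) 3)ᶜ) =
      (prodBernoulli (wOfList l)).real
          (openConn (0 : Fin 4) 1 ∩ openConn (1 : Fin 4) 2 ∩ (openConn (1 : Fin 4) 3)ᶜ) *
        (prodBernoulli (wOfList l)).real
          (openConn (0 : Fin 4) 3 ∩ openConn (3 : Fin 4) 2 ∩ (openConn (1 : Fin 4) 3)ᶜ) ∧
    0 < (prodBernoulli (wOfList l)).real
          (openConn (0 : Fin 4) 1 ∩ openConn (3 : Fin 4) 2 ∩ (openConn (1 : Fin 4) 3)ᶜ) *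
        (prodBernoulli (wOfList l)).real
          (openConn (0 : Fin 4) 3 ∩ openConn (1 : Fin 4) 2 ∩ (openConn (1 : Fin 4) 3)ᶜ) := by
  obtain ⟨h1, h2, h3, h4⟩ := tripod_cells_cycle4 l hl
  rw [h1, h2, h3, h4]
  norm_num

/-! ### §2 The four-relay one-cut bound is tight -/

/-- §2: on the witness, `E N = Σ_{a ∈ {1,2,3,4}} P(0 ↔ a) = 1 + 3/5 + 3/5 + 3/5 = 14/5`. -/
theorem sum_openConn_blobLink (l : List (Fin 5 × Fin 5 × ℚ))
    (hl : l = [(0, 1, 1), (1, 2, 3/5), (2, 3, 1), (3, 4, 1)]) :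
    (∑ a ∈ ({1, 2, 3, 4} : Finset (Fin 5)), (prodBernoulli (wOfList l)).real (openConn (0 : Fin 5) a)) =
      14 / 5 := by
  rw [Finset.sum_insert (by decide), Finset.sum_insert (by decide), Finset.sum_insert (by decide),
    Finset.sum_singleton]
  simp only [real_openConn_eq_wConn (blobLink_nodup l hl) (blobLink_weights l hl), ← Rat.cast_add,
    wConn_sum_blobLink l hl]
  norm_num

/-- §2: the pairwise hypothesis of `oneCut_card_le_four` holds on the witness with `t = 2/5`
(`P(1 ↮ a) = 2/5` for `a = 2, 3, 4`; the blob pairs have disconnection probability `0`). -/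
theorem pair_le_blobLink (l : List (Fin 5 × Fin 5 × ℚ))
    (hl : l = [(0, 1, 1), (1, 2, 3/5), (2, 3, 1), (3, 4, 1)]) :
    ∀ a ∈ ({1, 2, 3, 4} : Finset (Fin 5)), ∀ a' ∈ ({1, 2, 3, 4} : Finset (Fin 5)), a ≠ a' →
      (prodBernoulli (wOfList l)).real (openConn a a')ᶜ ≤ 2 / 5 := by
  intro a ha a' ha' _
  rw [real_compl_openConn_eq_wNotConn (blobLink_nodup l hl) (blobLink_weights l hl)]
  have h' : ((wNotConn (wtabs 5 l) a a' : ℚ) : ℝ) ≤ ((2/5 : ℚ) : ℝ) :=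
    Rat.cast_le.2 (wNotConn_blobLink_le l hl a ha a' ha')
  simpa using h'

/-- For a natural number `c`: `1 ≤ c ∧ c < (14/5)/2` iff `c = 1`. -/
theorem one_le_and_lt_iff (c : ℕ) : (1 ≤ c ∧ (c : ℝ) < 14 / 5 / 2) ↔ c = 1 := by
  constructor
  · rintro ⟨h1, h2⟩
    have h3 : (c : ℝ) < 2 := by linarith
    have h4 : c < 2 := by exact_mod_cast h3
    omega
  · rintro rfl
    norm_num

/-- **§2, tightness of the four-relay one-cut bound.**  On the witness with `o = 0`,
`A = {1,2,3,4}`: the one-cut event `{1 ≤ N < E N/2}` (`= {N = 1}` here) has probability exactly `2/5`,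
and so does `{1 ↮ 2}` — so with `t = 2/5` the hypotheses of `oneCut_card_le_four` hold
(`pair_le_blobLink`) and its conclusion `≤ t` is an equality. -/
theorem oneCut_card_le_four_tight (l : List (Fin 5 × Fin 5 × ℚ))
    (hl : l = [(0, 1, 1), (1, 2, 3/5), (2, 3, 1), (3, 4, 1)]) :
    (prodBernoulli (wOfList l)).real
        {ω : BondConfig (Fin 5) |
          1 ≤ (({1, 2, 3, 4} : Finset (Fin 5)).filter fun a => ω ∈ openConn (0 : Fin 5) a).card ∧
          ((({1, 2, 3, 4} : Finset (Fin 5)).filter fun a => ω ∈ openConn (0 : Fin 5) a).card : ℝ) <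
            (∑ a ∈ ({1, 2, 3, 4} : Finset (Fin 5)),
              (prodBernoulli (wOfList l)).real (openConn (0 : Fin 5) a)) / 2} = 2 / 5 ∧
      (prodBernoulli (wOfList l)).real (openConn (1 : Fin 5) (2 : Fin 5))ᶜ = 2 / 5 := by
  constructor
  · rw [sum_openConn_blobLink l hl]
    rw [real_eq_wcount (blobLink_nodup l hl) (blobLink_weights l hl)
      (fun tb => decide ((({1, 2, 3, 4} : Finset (Fin 5)).filter
        fun z : Fin 5 => (tb.getD 0 0).testBit z = true).card = 1)) _ fun ω => ?_]
    · rw [cntOne_blobLink l hl]; norm_num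
    · rw [decide_eq_true_eq, Set.mem_setOf_eq, ← card_filter_reachTable, one_le_and_lt_iff]
      rfl
  · rw [real_compl_openConn_eq_wNotConn (blobLink_nodup l hl) (blobLink_weights l hl),
      wNotConn_blobLink_one_two l hl]
    norm_num

/-- **§2, the theorem instantiated** (binders `n ↦ 5`, `w ↦ wOfList l`, `A ↦ {1,2,3,4}`, `o ↦ 0`,
`t ↦ 2/5`; side conditions `A.card ≤ 4`, `0 ≤ t` and the pairwise bound discharged): the bound the
card displays, at the tight instance — compare `oneCut_card_le_four_tight` (`= 2/5`). -/
theorem oneCut_blobLink_le (l : List (Fin 5 × Fin 5 × ℚ))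
    (hl : l = [(0, 1, 1), (1, 2, 3/5), (2, 3, 1), (3, 4, 1)]) :
    (prodBernoulli (wOfList l)).real
        {ω : BondConfig (Fin 5) |
          1 ≤ (({1, 2, 3, 4} : Finset (Fin 5)).filter fun a => ω ∈ openConn (0 : Fin 5) a).card ∧
          ((({1, 2, 3, 4} : Finset (Fin 5)).filter fun a => ω ∈ openConn (0 : Fin 5) a).card : ℝ) <
            (∑ a ∈ ({1, 2, 3, 4} : Finset (Fin 5)),
              (prodBernoulli (wOfList l)).real (openConn (0 : Fin 5) a)) / 2} ≤ 2 / 5 :=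
  Summit.CriticalPhenomena.PercolationContinuityZ3.Theorems.oneCut_card_le_four 5 (wOfList l)
    {1, 2, 3, 4} 0 (2 / 5) (by decide) (by norm_num) (pair_le_blobLink l hl)

/-! ### §3 The hypothesis-free five-relay variant T′(5) is false -/

/-- **§3, the witness.**  On `K₅` with weights `1/20`, `o = 0`, `A = univ`:
`P(1 ≤ N ≤ 2) = 307687881/320000000`, every pairwise disconnection probability is at most
`4824193716417/5120000000000 (< 307687881/320000000)`, with equality for the pair `(0, 1)`. -/
theorem tPrime5_cex (l : List (Fin 5 × Fin 5 × ℚ))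
    (hl : l = [(0, 1, 1/20), (0, 2, 1/20), (0, 3, 1/20), (0, 4, 1/20), (1, 2, 1/20), (1, 3, 1/20),
      (1, 4, 1/20), (2, 3, 1/20), (2, 4, 1/20), (3, 4, 1/20)]) :
    (prodBernoulli (wOfList l)).real
        {ω : BondConfig (Fin 5) |
          1 ≤ ((Finset.univ : Finset (Fin 5)).filter fun a => ω ∈ openConn (0 : Fin 5) a).card ∧
          ((Finset.univ : Finset (Fin 5)).filter fun a => ω ∈ openConn (0 : Fin 5) a).card ≤ 2} =
        307687881 / 320000000 ∧
      (∀ a ∈ (Finset.univ : Finset (Fin 5)), ∀ a' ∈ (Finset.univ : Finset (Fin 5)), a ≠ a' →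
        (prodBernoulli (wOfList l)).real (openConn a a')ᶜ ≤ 4824193716417 / 5120000000000) ∧
      (prodBernoulli (wOfList l)).real (openConn (0 : Fin 5) (1 : Fin 5))ᶜ =
        4824193716417 / 5120000000000 := by
  refine ⟨?_, ?_, ?_⟩
  · rw [real_eq_wcount (k5_nodup l hl) (k5_weights l hl)
      (fun tb => decide (1 ≤ ((Finset.univ : Finset (Fin 5)).filter
          fun z : Fin 5 => (tb.getD 0 0).testBit z = true).card ∧
        ((Finset.univ : Finset (Fin 5)).filter
          fun z : Fin 5 => (tb.getD 0 0).testBit z = true).card ≤ 2)) _ fun ω => ?_]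
    · rw [cntLe2_k5 l hl]; norm_num
    · rw [decide_eq_true_eq, Set.mem_setOf_eq, ← card_filter_reachTable]
      rfl
  · intro a _ a' _ _
    rw [real_compl_openConn_eq_wNotConn (k5_nodup l hl) (k5_weights l hl)]
    have h' : ((wNotConn (wtabs 5 l) a a' : ℚ) : ℝ) ≤ ((4824193716417/5120000000000 : ℚ) : ℝ) :=
      Rat.cast_le.2 (wNotConn_k5_le l hl a a')
    simpa using h'
  · rw [real_compl_openConn_eq_wNotConn (k5_nodup l hl) (k5_weights l hl), wNotConn_k5_zero_one l hl]
    norm_num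

/-- **§3, T′(5) refuted.**  The hypothesis-free five-relay variant — "if `|A| = 5`, `0 ≤ t` and
`P(a ↮ a') ≤ t` for all distinct `a, a' ∈ A`, then `P(1 ≤ N ≤ 2) ≤ t`" — is FALSE (witness: `K₅`
with weights `1/20`, `o = 0 ∈ A = univ`, `t = 4824193716417/5120000000000`; `tPrime5_cex`). -/
theorem not_tPrime5 :
    ¬ ∀ (n : ℕ) (w : Sym2 (Fin n) → unitInterval) (A : Finset (Fin n)) (o : Fin n) (t : ℝ),
        A.card = 5 → 0 ≤ t →
        (∀ a ∈ A, ∀ a' ∈ A, a ≠ a' → (prodBernoulli w).real (openConn a a')ᶜ ≤ t) →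
        (prodBernoulli w).real
          {ω : BondConfig (Fin n) |
            1 ≤ (A.filter fun a => ω ∈ openConn o a).card ∧
            (A.filter fun a => ω ∈ openConn o a).card ≤ 2} ≤ t := by
  intro h
  obtain ⟨h1, h2, -⟩ := tPrime5_cex _ rfl
  have h3 := h 5 _ Finset.univ 0 (4824193716417 / 5120000000000) (by simp) (by norm_num) h2
  rw [h1] at h3
  norm_num at h3

/-- §3: on the same witness `E N = Σ_a P(0 ↔ a) = 1575806283583/1280000000000 < 2`, so the one-cut
event `{1 ≤ N < E N/2}` of the headline statement is EMPTY here (`N ≥ 1 > E N/2`): T′(5) fails only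
because it drops the `E N/2` threshold. -/
theorem sum_openConn_k5 (l : List (Fin 5 × Fin 5 × ℚ))
    (hl : l = [(0, 1, 1/20), (0, 2, 1/20), (0, 3, 1/20), (0, 4, 1/20), (1, 2, 1/20), (1, 3, 1/20),
      (1, 4, 1/20), (2, 3, 1/20), (2, 4, 1/20), (3, 4, 1/20)]) :
    (∑ a : Fin 5, (prodBernoulli (wOfList l)).real (openConn (0 : Fin 5) a)) =
        1575806283583 / 1280000000000 ∧
      (1575806283583 / 1280000000000 : ℝ) < 2 := by
  refine ⟨?_, by norm_num⟩
  simp only [Fin.sum_univ_five, real_openConn_eq_wConn (k5_nodup l hl) (k5_weights l hl),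
    ← Rat.cast_add, wConn_sum_k5 l hl]
  norm_num

end Summit.CriticalPhenomena.PercolationContinuityZ3.Runbook.Primary
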